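import Literature.AnabelianGeometry.EtaleTheta.Discharge.Sec3PhiZeroCountablePrimes
import Literature.AnabelianGeometry.EtaleTheta.DivisorMonoidsOfGaloisCoveringConnected
import Literature.AlgebraicGeometry.Frobenioids.DirectSumPrimes
import HarnessLib

/-!
# Countably many primes of `Φ₀(Y)` and `Φ₀(Y)^pf` at the CONNECTED coverings — the Def. 3.3 (iii) data
# `DivisorMonoids.ofGaloisActionConnected` — from countability of `Gal(Z^log_∞/X^log)` alone (GAP-LEDGER G-L2d2-4)

S. Mochizuki, *The étale theta function and its Frobenioid-theoretic manifestations*, Publ. RIMS **45** (2009)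
[MochizukiEtTh2009], §3: Def. 3.3 (ii)/(iii) PDF p.73 — `Z^log_∞ → Z^log → X^log` with `Z^log → X^log` FINITE Galois and
`Z^log_∞ → Z^log` the universal combinatorial covering ("an infinite Galois étale covering", p.69), so that
`Gal(Z^log_∞/X^log)` is COUNTABLE, and "`D₀ := B^temp(X^log)⁰` … the connected objects", i.e. the connected coverings
`Y^log` between `X^log` and `Z^log_∞`, `Gal(Z^log_∞/Y^log) = H ≤ G`, `Y ↔ G/H`; Rmk. 3.3.1 p.73 ("the set of primes of
`Div⁺(Z^log_∞)^{Gal(Z^log_∞/Y^log)}` … is in natural bijective correspondence with the set of `Gal(Z^log_∞/Y^log)`-orbits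
of prime log-divisors") [cite: MochizukiEtTh2009, Rmk 3.3.1 p.73]; S. Mochizuki, *The geometry of Frobenioids I* (2008)
[MochizukiFrdI2008], §0 p.12 (`Prime(M) ⥲ Prime(M^pf)`).

abc-iut cell, layer L2, PROOF-ONLY sequel (theorems only: no `def`, no instance, no `Prop` fact), seat abc-iut-w6-d052
(gen 6), row R248 of abc-iut-L2-lead «hcnt PRODUCER (GAP G-L2d2-4)».  The `Φ₀`-level countability for a `G`-set `S`
with `[Countable S.V]` is abc-iut-w5-d153's `Sec3PhiZeroCountablePrimes.lean` (p440853, landed while this row was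
being typed — consumed BY NAME, nothing restated); abc-iut-w6-d058's `ofGaloisActionConnected` (p437704) is `D₀`
proper.  THIS FILE moves the cardinality binder from EACH covering `S` to the ONE group `G = Gal(Z^log_∞/X^log)`:
* `LogDivisorModel.GaloisAction.countable_of_isConnectedGSet` — a connected (nonempty, transitive) `G`-set is a
  quotient of `G`, hence countable when `G` is;
* `countable_primes[_perfection]_phiZero_of_isConnectedGSet` — `Prime(Φ₀(S))`, `Prime(Φ₀(S)^pf)` countable for every
  CONNECTED `S` under `[Countable G] [Countable Z.Cusp] [Countable Z.Comp]`;
* `DivisorMonoids.countable_primes[_perfection]_Φ₀_ofGaloisActionConnected` — the same at EVERY object `Y` of the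
  Def. 3.3 (iii) data of the connected coverings: the (R3)/`hcnt`-genre side condition of [EtTh] Cor. 3.8 (iii)
  (abc-iut-L2-d2's `cor38_iii_ofRlfZWeak_of_isFrobenioid_of_countable…`, `Sec3Cor38iiiOfRlfWeak.lean`) at the base
  monoids `Φ₀(Y_A)` of every tempered Frobenioid over `ofRlfZWeak (ofGaloisActionConnected A hZ) hpf`;
* generic companions: `GroupSaturatedSubmonoid.countable_primes_perfection` (countability of `Prime(P^pf)` descends
  to every perf-dense submonoid `M ≤ P`, via p432632 `nonempty_perfectionEquiv`) and `DirectSum.countable_primes`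
  (the free case `⊕_ι M_i` of monoprime monoids on a countable `ι`, abc-iut-L1-d2's `DirectSum.primesEquiv`).

HONEST LIMIT (= GAP row G-L2d2-4's own text): for an ABSTRACT `C : TemperedFrobenioid (ofRlfZWeak … hpf) D VD` the
binder `Countable (Primes (Perfection ↥(C.Φ.carrier A)))` is not derivable from Def. 3.6 (ii) as typed (`Prime(Φ(A))`
is not tied to `Prime(Φ₀(Y_A))`); a `Φ(A)` with `Φ(A)^pf ≅ Φ₀(Y_A)^pf` — e.g. perf-dense group-saturated sub-data,
`GroupSaturatedSubmonoid.countable_primes_perfection` — inherits the countability proved here through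
`countable_primes_of_mulEquiv`.  HONEST FRAMING: classical monoid bookkeeping over typed interfaces (`LogDivisorModel`
/ `GaloisAction` are parameter records — nothing asserts they arise from a curve); nothing here bears on [IUTchIII]
Cor. 3.12; typed ≠ proved — here proved.
-/

namespace Literature.AlgebraicGeometry.Frobenioids

open Function

universe u v

/-! ### Generic companions -/

/-- **The free case**: a direct sum `⊕_ι M_i` of monoprime monoids on a countable index type has countably many
primes (`Prime(⊕_ι M_i) ≃ ι`, abc-iut-L1-d2's `DirectSum.primesEquiv`; for `M_i = ℤ≥0` this is the free commutative
monoid on `ι`). [cite: MochizukiFrdI2008, §0 p.12] -/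
theorem DirectSum.countable_primes {ι : Type u} {M : ι → Type v} [∀ i, CommMonoid (M i)] [DecidableEq ι]
    (hM : ∀ i, IsMonoprime (M i)) [Countable ι] : Countable (Primes ↥(directSum M)) :=
  Countable.of_equiv ι (DirectSum.primesEquiv hM).symm

namespace GroupSaturatedSubmonoid

open Literature.AnabelianGeometry.EtaleTheta

variable {P : Type u} [CommMonoid P] {M : Submonoid P}

/-- **For a perf-dense submonoid `M ≤ P` (`∀ x ∈ P, ∃ n ≥ 1, xⁿ ∈ M`), `Prime(M^pf)` is countable as soon as
`Prime(P^pf)` is** — `M^pf ≅ P^pf` (p432632 `nonempty_perfectionEquiv`, the content of Prop. 3.2 (i)'s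
`Div⁺(Z^log_∞)^pf ⥲ DIV⁺(Z^log_∞)^pf`). [cite: MochizukiEtTh2009, Prop 3.2 p.70] -/
theorem countable_primes_perfection (hdense : ∀ x : P, x ∈ perfSaturation M)
    [Countable (Primes (Perfection P))] : Countable (Primes (Perfection ↥M)) := by
  obtain ⟨e⟩ := nonempty_perfectionEquiv hdense
  exact countable_primes_of_mulEquiv e.symm

end GroupSaturatedSubmonoid

end Literature.AlgebraicGeometry.Frobenioids

namespace Literature.AnabelianGeometry.EtaleTheta

open CategoryTheory Opposite Literature.AlgebraicGeometry.Frobenioids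

universe u

/-! ### Connected `G`-sets are quotients of `G` -/

namespace LogDivisorModel.GaloisAction

variable {Z : LogDivisorModel.{u}} {G : Type u} [Group G] (A : Z.GaloisAction G) (S : Action (Type u) G)

/-- **A connected (nonempty, transitive) `G`-set is countable when `G` is**: `g ↦ g · s₀` maps `G` onto `S`
(Def. 3.3 (ii)/(iii): the connected coverings `Y ↔ G/H`, `G = Gal(Z^log_∞/X^log)` countable).
[cite: MochizukiEtTh2009, Def 3.3 p.73] -/
theorem countable_of_isConnectedGSet [Countable G] {S : Action (Type u) G} (hS : isConnectedGSet S) :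
    Countable S.V := by
  obtain ⟨⟨s₀⟩, htrans⟩ := hS
  exact Function.Surjective.countable (f := fun g : G => S.ρ g s₀) fun t => htrans s₀ t

/-- **`Prime(Φ₀(S)^pf)` is countable for every CONNECTED covering `S`** as soon as `Gal(Z^log_∞/X^log)`, the cusps and
the irreducible components of the special fibre are countable (abc-iut-w5-d153's `countable_primes_perfection_phiZero`
at the quotient `S` of `G`). [cite: MochizukiEtTh2009, Rmk 3.3.1 p.73] -/
theorem countable_primes_perfection_phiZero_of_isConnectedGSet [Countable G] [Countable Z.Cusp] [Countable Z.Comp]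
    (hS : isConnectedGSet S) : Countable (Primes (Perfection ↥(A.phiZero S))) :=
  haveI := countable_of_isConnectedGSet hS
  countable_primes_perfection_phiZero A S

/-- … and so is `Prime(Φ₀(S))` itself. [cite: MochizukiEtTh2009, Rmk 3.3.1 p.73] -/
theorem countable_primes_phiZero_of_isConnectedGSet [Countable G] [Countable Z.Cusp] [Countable Z.Comp]
    (hS : isConnectedGSet S) : Countable (Primes ↥(A.phiZero S)) :=
  haveI := countable_of_isConnectedGSet hS
  countable_primes_phiZero A S

end LogDivisorModel.GaloisAction

/-! ### At the Def. 3.3 (iii) data of the connected coverings `ofGaloisActionConnected` -/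

namespace DivisorMonoids

open LogDivisorModel.GaloisAction

variable {Z : LogDivisorModel.{u}} {G : Type u} [Group G] (A : Z.GaloisAction G) (hZ : Z.CuspLaws)

/-- **`hcnt` at `D₀` proper**: for every object `Y` of the Def. 3.3 (iii) data of the CONNECTED coverings
(abc-iut-w6-d058's `DivisorMonoids.ofGaloisActionConnected A hZ`), `Prime(Φ₀(Y)^pf)` is countable, given countable
`Gal(Z^log_∞/X^log)`, cusps and special-fibre components (print: `Z → X` finite Galois composed with the universal
combinatorial covering; finitely many cusps; components of the special fibre). [cite: MochizukiEtTh2009, Def 3.3 p.73] -/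
theorem countable_primes_perfection_Φ₀_ofGaloisActionConnected [Countable G] [Countable Z.Cusp] [Countable Z.Comp]
    (Y : ((isConnectedGSet (G := G)).FullSubcategory)ᵒᵖ) :
    Countable (Primes (Perfection ↥((ofGaloisActionConnected A hZ).Φ₀.obj Y))) :=
  countable_primes_perfection_phiZero_of_isConnectedGSet A Y.unop.obj Y.unop.property

/-- … and `Prime(Φ₀(Y))` is countable there as well. [cite: MochizukiEtTh2009, Def 3.3 p.73] -/
theorem countable_primes_Φ₀_ofGaloisActionConnected [Countable G] [Countable Z.Cusp] [Countable Z.Comp]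
    (Y : ((isConnectedGSet (G := G)).FullSubcategory)ᵒᵖ) :
    Countable (Primes ↥((ofGaloisActionConnected A hZ).Φ₀.obj Y)) :=
  countable_primes_phiZero_of_isConnectedGSet A Y.unop.obj Y.unop.property

/-- **The same at the base object of any `A ∈ Ob(D)` of a tempered Frobenioid over these data** (the shape in which
abc-iut-L2-d2's `noPhantom_of_countable_weak` / `Sec3Cor38iiiOfRlfWeak` read the base monoid `Φ₀(Y_A)`: `dm.Φ₀.obj
(C.baseOp A)` with `dm := ofGaloisActionConnected A hZ`, `C.baseOp A = op (C.base.obj (unop A))`).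
[cite: MochizukiEtTh2009, Cor 3.8 p.82] -/
theorem countable_primes_perfection_Φ₀_ofGaloisActionConnected_baseOp [Countable G] [Countable Z.Cusp]
    [Countable Z.Comp] {D : Type*} [Category D] (base : D ⥤ (isConnectedGSet (G := G)).FullSubcategory)
    (A' : Dᵒᵖ) :
    Countable (Primes (Perfection ↥((ofGaloisActionConnected A hZ).Φ₀.obj (op (base.obj (unop A')))))) :=
  countable_primes_perfection_Φ₀_ofGaloisActionConnected A hZ _

end DivisorMonoids

end Literature.AnabelianGeometry.EtaleTheta
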